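import Summits.BirchSwinnertonDyer.BirchSwinnertonDyer.Theses.KatoDescentTamePotSupersingular
import Summits.BirchSwinnertonDyer.BirchSwinnertonDyer.Theorems.KatoDescentTamePotSupersingularTameUpperReducibleOfCountInputs
import HarnessLib

/-!
# Route `KatoDescentTamePotSupersingular` (rung K8-t′, cell `bsd-potss`): the GLUE
# `TameUpperReducibleDefectOfCountInputs` (item stmt-BirchSwinnertonDyer-19712) CLOSED — the six held cite-level
# inputs imply the crux U₀-red `TameUpperReducibleDefect` (item 19203)

The planner's glued split (KT rev 16, plan g15) of crux U₀-red 19203 `TameUpperReducibleDefect` — the UPPER half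
`ord_p #Ш ≤ ord_p #Ш_an` on the rank-`0` (t′) rows at `p ≠ 2` with `E[p]` reducible (a `ℤ/p²`-member in the
class or odd `ord_p #Ш_an`) — into the six HELD by-name alias children `PublishedInputIwasawaH1DataRedT`
(Kato's `𝐇¹` data), `PublishedInputNewformKatoRedT` (the newform), `PublishedInputMemberHullCountInputsT`
(Kato's SHARP rank-`0` member count, `Kato2004.exists_memberHullCountInputs`, reviewed fact p448371),
`PublishedInputCasselsIsogenyRedT` (Cassels), `PublishedInputRankEqAnalyticRankRedT` (GZK),
`PublishedInputEntireLFunctionRedT` (modularity) and the glue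
`TameUpperReducibleDefectOfCountInputs := C₁ → C₂ → C₃ → C₄ → C₅ → C₆ → TameUpperReducibleDefect`.
The glue is closed by seat kmc's g9 route-typed closer `Theorems.tameUpperReducibleDefect_of_memberCountInputs`
(p451821; mechanism in the route-free node file `KatoDescentPotSupersingularReducibleUpperOfCountInputsNodes.lean`:
the kernel exact count at Kato's member with `2t`, NO torsion slack, transported to `W` by Cassels) — every alias
child unfolds definitionally to the closer's hypothesis. UNCONDITIONAL theorem of the glue's exact type; on
acceptance the item closes and U₀-red on the (t′) reducible rank-`0` rows is SETTLED-BY-CITATION (modulo the one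
reviewed transcription, referee flag `Kato-14.9.3-count-Af-symbolic-member-reducible`). HONEST FRAMING: BSD is not
advanced by this file; the content of U₀-red (Kato's Euler-system bound at an additive prime with `E[p]`
reducible, read EXACTLY at his member) is unchanged; «closes glue 19712 of rung K8-t′ of BirchSwinnertonDyer»,
never summit credit. Seat `bsd-potss-k8t-c4` generation 5 (K9 twin: `wildUpperReducibleDefectOfCountInputs_proof`,
k9-c2 g7, glue 19711).

References: [Kato2004Asterisque] §14.8 (p. 238), (14.9.3) (p. 240), proof of Prop. 14.16 (pp. 244–245), Thm. 12.6
(p. 222); [GreenbergLNM1716] §3; [Cassels1965ArithmeticVIII]; [GrossZagier1986], [Kolyvagin1990Euler];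
[BCDT2001].
-/

set_option autoImplicit false
-- sibling precedent (`KatoDescentTamePotSupersingularAssembly.lean`): the directory name repeats the summit name
set_option linter.dupNamespace false

noncomputable section

namespace Summit.BirchSwinnertonDyer.BirchSwinnertonDyer.Theorems

/-- **Glue 19712 `TameUpperReducibleDefectOfCountInputs` holds** (type = the route decl VERBATIM):
`PublishedInputIwasawaH1DataRedT → PublishedInputNewformKatoRedT → PublishedInputMemberHullCountInputsT →
PublishedInputCasselsIsogenyRedT → PublishedInputRankEqAnalyticRankRedT → PublishedInputEntireLFunctionRedT →
TameUpperReducibleDefect`, by kmc g9's `tameUpperReducibleDefect_of_memberCountInputs` (p451821) — each held alias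
child is a `Sort 0`/`Prop` ascription of the corresponding Literature fact and unfolds definitionally.
UNCONDITIONAL (the six inputs are the glue's own antecedents). Closes item stmt-BirchSwinnertonDyer-19712; the
parent crux 19203 is thereby settled modulo its held cite-level children.
[cite: Kato2004Asterisque, (14.9.3) (p. 240) and proof of Prop. 14.16 (pp. 244–245), Thm. 12.6 (p. 222)]
[cite: Cassels1965ArithmeticVIII] -/
theorem tameUpperReducibleDefectOfCountInputs_proof :
    Summit.BirchSwinnertonDyer.BirchSwinnertonDyer.Theses.KatoDescentTamePotSupersingular.TameUpperReducibleDefectOfCountInputs :=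
  fun h₁ h₂ h₃ h₄ h₅ h₆ ↦ tameUpperReducibleDefect_of_memberCountInputs h₁ h₂ h₃ h₄ h₅ h₆

end Summit.BirchSwinnertonDyer.BirchSwinnertonDyer.Theorems

end
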